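import Summits.BirchSwinnertonDyer.BirchSwinnertonDyer.Theses.GenusKolyvaginAtTwo
import Literature.NumberTheory.EllipticCurves.KummerSelmerStructure
import Literature.NumberTheory.GaloisRepresentations.LocalGlobalCohomology
import HarnessLib

/-!
# R9 KIT — FINAL CONSOLIDATION (LEAD gk2-p1 g20 R9 + A9.1, gk2-p2 g22 R9-L), 2026-08-30 — THE Δ>0 HALF OF `closes` ON THE CUT: proposed restatements + the re-glued deciding theorem,
# elaborated against route `GenusKolyvaginAtTwo` rev 42 (local `def`s = the proposed item texts; `closesN` = `closes` with the Δ>0 branch re-glued)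

NOT a proposal to the gate (sketch for the route pen `bsd-idea-1` / planner-of-record `-imc`).  BSD is NOT proved by any of this.

PROPOSED EDITS (mirror of R7-d/R8 on Δ<0):
* U⁺_T′ `ShaCardDvdPowAtTwoPosT'` := 23378 restated onto the cut — antecedent Q2, an odd multiplicative prime (NPh), `w(E) = 1`, a globally
  minimal 2-Selmer-minimal twin model `Wd` with `ord₂ c(Wd) = 0`; idle Kolyvagin binders dropped (= the LEAD skeleton's live branch:
  B2Q⁺ sign-free ∘ ONCUT⁺).
* Q4_T′ `KolyvaginExactAtTwoPosDiscT'` := 23240 with the same insertions (Kolyvagin binders kept for L⁺_T); glue′ U⁺_T′ → L⁺_T → Q4_T′ (below,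
  proved); L⁺_T 23379 UNCHANGED.
* supply⁺ `GenusPrimitiveSupplyAtTwoPosDiscShallow` := 22136 restricted to `0 < W.Δ` and the REAL-NARROW Selmer cells `#Sel₂(E) = 1 ∨ (#Sel₂(E) = 4 ∧
  some 2-Selmer class of E non-trivial at the real place)` (necessity: gk2-p3 RANKQ⁺ p754093 + LEAD `…PosTSupplyRealShift` — a Tamagawa-odd
  Sel₂-minimal twin forces `#Sel₂(E) ∣ 4`, and on `#Sel₂(E) = 4` it forces `Sel₂(E)` non-strict at `∞`), with `padicValNat 2 Wd.tamagawaProduct = 0` appended.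
* residuals: `AdditiveOnlyResidualAtTwo` := 24826 minus `W.Δ < 0` (SIGN-FREE, no new item); 23492 `WideSelmerResidualAtTwoNegDisc` UNCHANGED;
  NEW declared residual slice `WideSelmerResidualAtTwoPosDisc` (A9.1: on Δ>0 the supply's narrow hypothesis carries a REAL-PLACE clause —
  `#Sel₂(E) = 1 ∨ (#Sel₂(E) = 4 ∧ Sel₂(E) not strict at ∞)` — whose necessity is LEAD `…PosTSupplyRealShift` (MR Cor. 3.4 (i), T = {∞});
  the complement (wide, or real-strict `(ℤ/2)²`) is this residual).
* `closesN`: the Δ>0 branch dispatches `by_cases hmult`, `by_cases h14⁺` exactly like the Δ<0 branch.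
-/

namespace Summit.BirchSwinnertonDyer.BirchSwinnertonDyer.Cruxes.ShaCardDvdPowAtTwoPosT.R9final

open Summit.BirchSwinnertonDyer.BirchSwinnertonDyer.Theses.GenusKolyvaginAtTwo
open WeierstrassCurve Literature.NumberTheory.EllipticCurves Literature.NumberTheory.EllipticCurves.ModularForms

/-- PROPOSED U⁺_T′ (restatement of stmt-BirchSwinnertonDyer-23378 onto the cut). -/
def ShaCardDvdPowAtTwoPosT' : Prop :=
  KolyvaginRelationAtTwo → ∀ (W : WeierstrassCurve ℚ) [W.IsElliptic] [W.IsGloballyMinimal] [NeZero (W.conductorNorm ℤ)], ¬ W.HasCM → Odd W.tamagawaProduct → ∀ (v : IsDedekindDomain.HeightOneSpectrum (NumberField.RingOfIntegers ℚ)), ((2 : ℕ) : NumberField.RingOfIntegers ℚ) ∉ v.asIdeal → ((W.conductorNorm ℤ : ℕ) : NumberField.RingOfIntegers ℚ) ∈ v.asIdeal → W.HasMultiplicativeReductionAt v → 0 < W.Δ → ∀ (K : Type) [Field K] [NumberField K], Literature.NumberTheory.EllipticCurves.IsImaginaryQuadratic K → Odd (NumberField.discr K) → NumberField.discr K ≠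 -3 → Literature.NumberTheory.EllipticCurves.SatisfiesHeegnerHypothesis (W.conductorNorm ℤ) K → ¬ IsSquare ((NumberField.discr K : ℚ) * -|W.Δ|) → ¬ IsSquare ((NumberField.discr K : ℚ) * (-(2 * |W.Δ|))) → (∀ n : ℕ, 0 < n → W.HasSurjectiveModNGaloisRep ((2 : ℤ) ^ n)) → ∀ (Dt : Literature.NumberTheory.EllipticCurves.ModularForms.ModularParametrizationData W (W.conductorNorm ℤ)) (β : ℤ) (ι : K →+* ℂ) (d₁ : Literature.NumberTheory.EllipticCurves.KolyvaginHeegnerData Dt β ι 1), ¬ IsOfFinAddOrder d₁.derivedPoint → ∀ (M₀ : ℕ), (∃ Q : (W.baseChange (Literature.NumberTheory.EllipticCurves.ringClassField K ι 1)).toAffine.Point, ((2 ^ M₀ : ℕ) : ℤ) • Q = d₁.derivedPoint) → (¬ ∃ Q : (W.baseChange (Literature.NumberTheory.EllipticCurves.ringClassField K ι 1)).toAffine.Point, ((2 ^ (M₀ + 1) : ℕ) : ℤ) • Q = d₁.derivedPoint) → W.rootNumber = 1 → ∀ (Wd : WeierstrassCurve ℚ) [Wd.IsElliptic] [Wd.IsGloballyMinimal],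 (∃ C : WeierstrassCurve.VariableChange ℚ, C • W.quadraticTwist (NumberField.discr K : ℚ) = Wd) → Nat.card (Wd.selmerGroup 2) = 2 → padicValNat 2 Wd.tamagawaProduct = 0 → Nat.card (AddCommGroup.primaryComponent (W.baseChange K).sha 2) ∣ 2 ^ (2 * M₀)

/-- PROPOSED Q4_T″ (restatement of stmt-BirchSwinnertonDyer-23240 onto the cut WITH the transposition-deep witness clause of R9-L; Kolyvagin binders kept). -/
def KolyvaginExactAtTwoPosDiscT'' : Prop :=
  KolyvaginRelationAtTwo → ∀ (W : WeierstrassCurve ℚ) [W.IsElliptic] [W.IsGloballyMinimal] [NeZero (W.conductorNorm ℤ)], ¬ W.HasCM → Odd W.tamagawaProduct → ∀ (v : IsDedekindDomain.HeightOneSpectrum (NumberField.RingOfIntegers ℚ)), ((2 : ℕ) : NumberField.RingOfIntegers ℚ) ∉ v.asIdeal → ((W.conductorNorm ℤ : ℕ) : NumberField.RingOfIntegers ℚ) ∈ v.asIdeal → W.HasMultiplicativeReductionAt v → 0 < W.Δ → ∀ (K : Type) [Field K] [NumberField K], Literature.NumberTheory.EllipticCurves.IsImaginaryQuadratic K → Odd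 (NumberField.discr K) → NumberField.discr K ≠ -3 → Literature.NumberTheory.EllipticCurves.SatisfiesHeegnerHypothesis (W.conductorNorm ℤ) K → ¬ IsSquare ((NumberField.discr K : ℚ) * -|W.Δ|) → ¬ IsSquare ((NumberField.discr K : ℚ) * (-(2 * |W.Δ|))) → (∀ n : ℕ, 0 < n → W.HasSurjectiveModNGaloisRep ((2 : ℤ) ^ n)) → ∀ (Dt : Literature.NumberTheory.EllipticCurves.ModularForms.ModularParametrizationData W (W.conductorNorm ℤ)) (β : ℤ) (ι : K →+* ℂ) (d₁ : Literature.NumberTheory.EllipticCurves.KolyvaginHeegnerData Dt β ι 1), ¬ IsOfFinAddOrder d₁.derivedPoint → ∀ (M₀ : ℕ), (∃ Q : (W.baseChange (Literature.NumberTheory.EllipticCurves.ringClassField K ι 1)).toAffine.Point, ((2 ^ M₀ : ℕ) : ℤ) • Q = d₁.derivedPoint) → (¬ ∃ Q : (W.baseChange (Literature.NumberTheory.EllipticCurves.ringClassField K ι 1)).toAffine.Point, ((2 ^ (M₀ + 1) : ℕ) : ℤ) • Q = d₁.derivedPoint) → W.rootNumber = 1 → ∀ (Wd : WeierstrassCurve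 ℚ) [Wd.IsElliptic] [Wd.IsGloballyMinimal], (∃ C : WeierstrassCurve.VariableChange ℚ, C • W.quadraticTwist (NumberField.discr K : ℚ) = Wd) → Nat.card (Wd.selmerGroup 2) = 2 → padicValNat 2 Wd.tamagawaProduct = 0 → ∀ (n : ℕ) (d : Literature.NumberTheory.EllipticCurves.KolyvaginHeegnerData Dt β ι n), Squarefree n → (∀ ℓ ∈ n.primeFactors, Literature.NumberTheory.EllipticCurves.Zhang2014.IsKolyvaginPrime (W.conductorNorm ℤ) W K 2 ℓ ∧ 2 ≤ Literature.NumberTheory.EllipticCurves.Zhang2014.kolyvaginIndex W 2 ℓ ∧ ∃ (v : IsDedekindDomain.HeightOneSpectrum (NumberField.RingOfIntegers ℚ)) (𝔓 : Ideal (Literature.NumberTheory.GaloisRepresentations.absIntegers (NumberField.RingOfIntegers ℚ) ℚ)) (h : Field.absoluteGaloisGroup ℚ), ((ℓ : ℕ) : NumberField.RingOfIntegers ℚ) ∈ v.asIdeal ∧ 𝔓 ∈ v.primesAbove ∧ IsArithFrobAt (NumberField.RingOfIntegers ℚ) h 𝔓 ∧ ∃ u : W.geomTorsion ((2 : ℕ)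 : ℤ), h • u ≠ u) → (¬ ∃ Q : (W.baseChange (Literature.NumberTheory.EllipticCurves.ringClassField K ι n)).toAffine.Point, (2 : ℤ) • Q = d.derivedPoint) → Nat.card (AddCommGroup.primaryComponent (W.baseChange K).sha 2) = 2 ^ (2 * M₀)

/-- PROPOSED L⁺_T′ (R9-L, gk2-p2 g22; restatement of stmt-BirchSwinnertonDyer-23379): Q4_T″'s frame and witness clause, conclusion `2^(2M₀) ∣ #Ш`. -/
def PowDvdShaCardAtTwoPosT' : Prop :=
  KolyvaginRelationAtTwo → ∀ (W : WeierstrassCurve ℚ) [W.IsElliptic] [W.IsGloballyMinimal] [NeZero (W.conductorNorm ℤ)], ¬ W.HasCM → Odd W.tamagawaProduct → ∀ (v : IsDedekindDomain.HeightOneSpectrum (NumberField.RingOfIntegers ℚ)), ((2 : ℕ) : NumberField.RingOfIntegers ℚ) ∉ v.asIdeal → ((W.conductorNorm ℤ : ℕ) : NumberField.RingOfIntegers ℚ) ∈ v.asIdeal → W.HasMultiplicativeReductionAt v → 0 < W.Δ → ∀ (K : Type) [Field K] [NumberField K], Literature.NumberTheory.EllipticCurves.IsImaginaryQuadratic K →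 Odd (NumberField.discr K) → NumberField.discr K ≠ -3 → Literature.NumberTheory.EllipticCurves.SatisfiesHeegnerHypothesis (W.conductorNorm ℤ) K → ¬ IsSquare ((NumberField.discr K : ℚ) * -|W.Δ|) → ¬ IsSquare ((NumberField.discr K : ℚ) * (-(2 * |W.Δ|))) → (∀ n : ℕ, 0 < n → W.HasSurjectiveModNGaloisRep ((2 : ℤ) ^ n)) → ∀ (Dt : Literature.NumberTheory.EllipticCurves.ModularForms.ModularParametrizationData W (W.conductorNorm ℤ)) (β : ℤ) (ι : K →+* ℂ) (d₁ : Literature.NumberTheory.EllipticCurves.KolyvaginHeegnerData Dt β ι 1), ¬ IsOfFinAddOrder d₁.derivedPoint → ∀ (M₀ : ℕ), (∃ Q : (W.baseChange (Literature.NumberTheory.EllipticCurves.ringClassField K ι 1)).toAffine.Point, ((2 ^ M₀ : ℕ) : ℤ) • Q = d₁.derivedPoint) → (¬ ∃ Q : (W.baseChange (Literature.NumberTheory.EllipticCurves.ringClassField K ι 1)).toAffine.Point, ((2 ^ (M₀ + 1) : ℕ) : ℤ) • Q = d₁.derivedPoint) → W.rootNumber = 1 → ∀ (Wd : WeierstrassCurve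 ℚ) [Wd.IsElliptic] [Wd.IsGloballyMinimal], (∃ C : WeierstrassCurve.VariableChange ℚ, C • W.quadraticTwist (NumberField.discr K : ℚ) = Wd) → Nat.card (Wd.selmerGroup 2) = 2 → padicValNat 2 Wd.tamagawaProduct = 0 → ∀ (n : ℕ) (d : Literature.NumberTheory.EllipticCurves.KolyvaginHeegnerData Dt β ι n), Squarefree n → (∀ ℓ ∈ n.primeFactors, Literature.NumberTheory.EllipticCurves.Zhang2014.IsKolyvaginPrime (W.conductorNorm ℤ) W K 2 ℓ ∧ 2 ≤ Literature.NumberTheory.EllipticCurves.Zhang2014.kolyvaginIndex W 2 ℓ ∧ ∃ (v : IsDedekindDomain.HeightOneSpectrum (NumberField.RingOfIntegers ℚ)) (𝔓 : Ideal (Literature.NumberTheory.GaloisRepresentations.absIntegers (NumberField.RingOfIntegers ℚ) ℚ)) (h : Field.absoluteGaloisGroup ℚ), ((ℓ : ℕ) : NumberField.RingOfIntegers ℚ) ∈ v.asIdeal ∧ 𝔓 ∈ v.primesAbove ∧ IsArithFrobAt (NumberField.RingOfIntegers ℚ) h 𝔓 ∧ ∃ u : W.geomTorsion ((2 : ℕ)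 : ℤ), h • u ≠ u) → (¬ ∃ Q : (W.baseChange (Literature.NumberTheory.EllipticCurves.ringClassField K ι n)).toAffine.Point, (2 : ℤ) • Q = d.derivedPoint) → 2 ^ (2 * M₀) ∣ Nat.card (AddCommGroup.primaryComponent (W.baseChange K).sha 2)

/-- PROPOSED glue″ (re-proof of stmt-BirchSwinnertonDyer-23380 against the restated texts): U⁺_T′ → L⁺_T′ → Q4_T″. -/
theorem kolyvaginExactAtTwoPosDiscTOfHalves'' : ShaCardDvdPowAtTwoPosT' → PowDvdShaCardAtTwoPosT' → KolyvaginExactAtTwoPosDiscT'' := by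
  intro hU hL hQ2 W _ _ _ hcm hT v h2v hNv hmult hpos K _ _ hIQ hodd h3 hHe hsq1 hsq2 hρ Dt β ι d₁ hy M₀ hdiv hndiv hw Wd _ _ hWd hSel hTam
    n d hn hKoly hPn
  exact Nat.dvd_antisymm (hU hQ2 W hcm hT v h2v hNv hmult hpos K hIQ hodd h3 hHe hsq1 hsq2 hρ Dt β ι d₁ hy M₀ hdiv hndiv hw Wd hWd hSel hTam)
    (hL hQ2 W hcm hT v h2v hNv hmult hpos K hIQ hodd h3 hHe hsq1 hsq2 hρ Dt β ι d₁ hy M₀ hdiv hndiv hw Wd hWd hSel hTam n d hn hKoly hPn)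

/-- L⁺_T′ is WEAKER than L⁺_T as filed: the filed text implies the restated one (gk2-p2 g22 `powDvdShaCardAtTwoPosT'_of_filed`). -/
theorem powDvdShaCardAtTwoPosT'_of_filed (h : PowDvdShaCardAtTwoPosT) : PowDvdShaCardAtTwoPosT' := by
  intro _hQ2 W _ _ _ hcm hT _v _h2v _hNv _hmult hpos K _ _ hIQ hodd h3 hHe hsq1 hsq2 hρ Dt β ι d₁ hy M₀ hdiv hndiv _hw _Wd _ _ _hWd _hSel _hTam
    n d hn hKoly hPn
  exact h W hcm hT hpos K hIQ hodd h3 hHe hsq1 hsq2 hρ Dt β ι d₁ hy M₀ hdiv hndiv n d hn (fun ℓ hℓ ↦ (hKoly ℓ hℓ).1) hPn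

/-- PROPOSED supply⁺ (the Δ>0 supply on the narrow Selmer cells, with the SHALLOW clause `ord₂ c(Wd) = 0` appended; = 22136's text with
`0 < W.Δ →` and `(#Sel₂(E) = 1 ∨ #Sel₂(E) = 4) →` inserted and `∧ padicValNat 2 Wd.tamagawaProduct = 0` appended; OUTPUT witness in the transposition-deep currency of R9-L). -/
def GenusPrimitiveSupplyAtTwoPosDiscShallow'' : Prop :=
  ∀ (W : WeierstrassCurve ℚ) [W.IsElliptic] [W.IsGloballyMinimal] [NeZero (W.conductorNorm ℤ)], ¬ W.HasCM → W.analyticRank = 0 → (∀ n : ℕ, 0 < n → W.HasSurjectiveModNGaloisRep ((2 : ℤ) ^ n)) → Odd W.tamagawaProduct → 0 < W.Δ → (∃ Dt : Literature.NumberTheory.EllipticCurves.ModularForms.ModularParametrizationData W (W.conductorNorm ℤ), (∀ z ∈ Dt.L.lattice, ∃ w ∈ Literature.NumberTheory.EllipticCurves.ModularForms.periodLattice Dt.f, z = (Dt.c : ℂ) * w) ∧ Odd Dt.c) → (Nat.card (W.selmerGroup 2) = 1 ∨ (Nat.card (W.selmerGroup 2) = 4 ∧ ∃ c ∈ (W.kummerSelmerStructure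 ((2 : ℕ) : ℤ)).selmerGroup, Literature.NumberTheory.GaloisRepresentations.galoisCohomology.localization (W.torsionGaloisModule ((2 : ℕ) : ℤ)) (Sum.inl Rat.infinitePlace) 1 c ≠ 0)) → ∃ (K : Type) (_ : Field K) (_ : NumberField K), Literature.NumberTheory.EllipticCurves.IsImaginaryQuadratic K ∧ Odd (NumberField.discr K) ∧ NumberField.discr K ≠ -3 ∧ Literature.NumberTheory.EllipticCurves.SatisfiesHeegnerHypothesis (W.conductorNorm ℤ) K ∧ ¬ IsSquare ((NumberField.discr K : ℚ) * -|W.Δ|) ∧ ¬ IsSquare ((NumberField.discr K : ℚ) * (-(2 * |W.Δ|))) ∧ ∃ (Dt : Literature.NumberTheory.EllipticCurves.ModularForms.ModularParametrizationData W (W.conductorNorm ℤ)) (β : ℤ) (ι : K →+* ℂ) (d₁ : Literature.NumberTheory.EllipticCurves.KolyvaginHeegnerData Dt β ι 1), (∀ z ∈ Dt.L.lattice, ∃ w ∈ Literature.NumberTheory.EllipticCurves.ModularForms.periodLattice Dt.f, z = (Dt.c : ℂ) * w) ∧ Odd Dt.c ∧ ¬ IsOfFinAddOrder d₁.derivedPoint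 ∧ ∃ M₀ : ℕ, (∃ Q : (W.baseChange (Literature.NumberTheory.EllipticCurves.ringClassField K ι 1)).toAffine.Point, ((2 ^ M₀ : ℕ) : ℤ) • Q = d₁.derivedPoint) ∧ (¬ ∃ Q : (W.baseChange (Literature.NumberTheory.EllipticCurves.ringClassField K ι 1)).toAffine.Point, ((2 ^ (M₀ + 1) : ℕ) : ℤ) • Q = d₁.derivedPoint) ∧ ∃ (n : ℕ) (d : Literature.NumberTheory.EllipticCurves.KolyvaginHeegnerData Dt β ι n), Squarefree n ∧ (∀ ℓ ∈ n.primeFactors, Literature.NumberTheory.EllipticCurves.Zhang2014.IsKolyvaginPrime (W.conductorNorm ℤ) W K 2 ℓ ∧ 2 ≤ Literature.NumberTheory.EllipticCurves.Zhang2014.kolyvaginIndex W 2 ℓ ∧ ∃ (v : IsDedekindDomain.HeightOneSpectrum (NumberField.RingOfIntegers ℚ)) (𝔓 : Ideal (Literature.NumberTheory.GaloisRepresentations.absIntegers (NumberField.RingOfIntegers ℚ) ℚ)) (h : Field.absoluteGaloisGroup ℚ), ((ℓ : ℕ) : NumberField.RingOfIntegers ℚ) ∈ v.asIdeal ∧ 𝔓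 ∈ v.primesAbove ∧ IsArithFrobAt (NumberField.RingOfIntegers ℚ) h 𝔓 ∧ ∃ u : W.geomTorsion ((2 : ℕ) : ℤ), h • u ≠ u) ∧ (¬ ∃ Q : (W.baseChange (Literature.NumberTheory.EllipticCurves.ringClassField K ι n)).toAffine.Point, (2 : ℤ) • Q = d.derivedPoint) ∧ ∃ (Wd : WeierstrassCurve ℚ) (_ : Wd.IsElliptic) (_ : Wd.IsGloballyMinimal), (∃ C : WeierstrassCurve.VariableChange ℚ, C • W.quadraticTwist (NumberField.discr K : ℚ) = Wd) ∧ ¬ Wd.HasCM ∧ Wd.analyticRank = 1 ∧ Nat.card (Wd.selmerGroup 2) = 2 ∧ padicValNat 2 Wd.tamagawaProduct = 0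

/-- PROPOSED sign-free additive-only residual (= stmt-BirchSwinnertonDyer-24826 with `W.Δ < 0 →` deleted). -/
def AdditiveOnlyResidualAtTwo : Prop :=
  ∀ (W : WeierstrassCurve ℚ) [W.IsElliptic] [W.IsGloballyMinimal] [NeZero (W.conductorNorm ℤ)], ¬ W.HasCM → W.analyticRank = 0 → (∀ n : ℕ, 0 < n → W.HasSurjectiveModNGaloisRep ((2 : ℤ) ^ n)) → Odd W.tamagawaProduct → (∃ Dt : Literature.NumberTheory.EllipticCurves.ModularForms.ModularParametrizationData W (W.conductorNorm ℤ), (∀ z ∈ Dt.L.lattice, ∃ w ∈ Literature.NumberTheory.EllipticCurves.ModularForms.periodLattice Dt.f, z = (Dt.c : ℂ) * w) ∧ Odd Dt.c) → (¬ ∃ v : IsDedekindDomain.HeightOneSpectrum (NumberField.RingOfIntegers ℚ), ((2 : ℕ) : NumberField.RingOfIntegers ℚ) ∉ v.asIdeal ∧ ((W.conductorNorm ℤ : ℕ) : NumberField.RingOfIntegers ℚ) ∈ v.asIdeal ∧ W.HasMultiplicativeReductionAt v) → Literature.NumberTheory.EllipticCurves.BSDp W 2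

/-- PROPOSED Δ>0 wide/real-strict residual (NEW declared residual slice; 23492 `WideSelmerResidualAtTwoNegDisc` stays as is): the Δ>0 habitat
cells with an odd multiplicative prime on which NO Tamagawa-odd 2-Selmer-minimal Heegner twin can exist — `#Sel₂(E) ∉ {1,4}`, or `#Sel₂(E) = 4` with
`Sel₂(E)` strict at the real place (necessity: LEAD `…PosTSupplyRealShift`, MR Cor. 3.4 (i) at `T = {∞}`). -/
def WideSelmerResidualAtTwoPosDisc : Prop :=
  ∀ (W : WeierstrassCurve ℚ) [W.IsElliptic] [W.IsGloballyMinimal] [NeZero (W.conductorNorm ℤ)], ¬ W.HasCM → W.analyticRank = 0 → (∀ n : ℕ, 0 < n → W.HasSurjectiveModNGaloisRep ((2 : ℤ) ^ n)) → Odd W.tamagawaProduct → (∃ Dt : Literature.NumberTheory.EllipticCurves.ModularForms.ModularParametrizationData W (W.conductorNorm ℤ), (∀ z ∈ Dt.L.lattice, ∃ w ∈ Literature.NumberTheory.EllipticCurves.ModularForms.periodLattice Dt.f, z = (Dt.c : ℂ) * w) ∧ Odd Dt.c) → 0 < W.Δ → (∃ v : IsDedekindDomain.HeightOneSpectrum (NumberField.RingOfIntegers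 ℚ), ((2 : ℕ) : NumberField.RingOfIntegers ℚ) ∉ v.asIdeal ∧ ((W.conductorNorm ℤ : ℕ) : NumberField.RingOfIntegers ℚ) ∈ v.asIdeal ∧ W.HasMultiplicativeReductionAt v) → ¬ (Nat.card (W.selmerGroup 2) = 1 ∨ (Nat.card (W.selmerGroup 2) = 4 ∧ ∃ c ∈ (W.kummerSelmerStructure ((2 : ℕ) : ℤ)).selmerGroup, Literature.NumberTheory.GaloisRepresentations.galoisCohomology.localization (W.torsionGaloisModule ((2 : ℕ) : ℤ)) (Sum.inl Rat.infinitePlace) 1 c ≠ 0)) → Literature.NumberTheory.EllipticCurves.BSDp W 2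

/-- The old NegDisc residuals follow from the sign-free ones (so the Δ<0 branches of `closes` are untouched). -/
theorem additiveOnlyResidualAtTwoNegDisc_of (h : AdditiveOnlyResidualAtTwo) : AdditiveOnlyResidualAtTwoNegDisc :=
  fun W _ _ _ hcm hr0 hρ hT hopt _ hmult ↦ h W hcm hr0 hρ hT hopt hmult

/-- **`closesN`: the deciding theorem re-glued with the Δ>0 branch on the cut** — `closes` (rev 42) with `hP ↦ hP'` (supply⁺), `hQ4T ↦ hQ4T'`,
`hAdd/hWide ↦` their sign-free forms; the Δ<0 branch is byte-identical, the Δ>0 branch is its mirror (`by_cases hmult`, `by_cases h14`). -/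
theorem closesN (hP : GenusPrimitiveSupplyAtTwoPosDiscShallow'') (hPG : GenusDeepSupplyAtTwoNegDiscNarrow) (hQ1 : CyclicTorsionOfNegDisc)
    (hQ2 : KolyvaginRelationAtTwo)
    (hQ5R : EquivariantChebotarevAtTwoR) (hQ3RT : EquivariantKolyvaginExactAtTwoRT)
    (hQ4T : KolyvaginExactAtTwoPosDiscT'') (hGf : ExactDescentAtTwoOfFourFacts)
    (hR : OffHabitatResidualAtTwo) (hAdd : AdditiveOnlyResidualAtTwo) (hWide : WideSelmerResidualAtTwoNegDisc)
    (hWidePos : WideSelmerResidualAtTwoPosDisc)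
    (hTw : MinimalTwinBSDTwo) (hL : EntireLFunctionRat)
    (hGZ : GrossZagierAllLevels) (hGZK : MultPublishedInputsAtTwo) (hMi : MilneAnyModel) :
    Summit.BirchSwinnertonDyer.BirchSwinnertonDyer.Rank1Residual.NonCMAtTwo := by
  have hG : ExactDescentAtTwo := hGf ⟨hGZ, hGZK, hL, hMi⟩
  intro W _ _ hcm hr
  haveI : NeZero (W.conductorNorm ℤ) := ⟨(W.conductorNorm_pos_holds).ne'⟩
  by_cases hH : (W.analyticRank = 0 ∧ (∀ n : ℕ, 0 < n → W.HasSurjectiveModNGaloisRep ((2 : ℤ) ^ n)) ∧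
        Odd W.tamagawaProduct ∧
        ∃ Dt : Literature.NumberTheory.EllipticCurves.ModularForms.ModularParametrizationData W (W.conductorNorm ℤ),
          (∀ z ∈ Dt.L.lattice, ∃ w ∈ Literature.NumberTheory.EllipticCurves.ModularForms.periodLattice Dt.f, z = (Dt.c : ℂ) * w) ∧ Odd Dt.c)
  · obtain ⟨hr0, hρ, hT, hopt⟩ := hH
    -- an elliptic curve has `Δ ≠ 0`
    have hΔ : W.Δ ≠ 0 := by rw [← WeierstrassCurve.coe_Δ']; exact W.Δ'.ne_zero
    -- `w(E) = +1` from `r_an(E) = 0` (used on both signs now)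
    have hw : ∀ Dt : ModularParametrizationData W (W.conductorNorm ℤ), W.rootNumber = 1 := fun Dt ↦
      (Literature.Barriers.BirchSwinnertonDyer.even_analyticRank_iff_of_isNewformOf_conductorLevel Dt.isNewformOf).mp
        (by rw [hr0]; exact Even.zero)
    rcases lt_or_gt_of_ne hΔ with hneg | hpos
    · -- `Δ < 0`: byte-identical to rev 42
      by_cases hmult : ∃ v : IsDedekindDomain.HeightOneSpectrum (NumberField.RingOfIntegers ℚ),
          ((2 : ℕ) : NumberField.RingOfIntegers ℚ) ∉ v.asIdeal ∧
          ((W.conductorNorm ℤ : ℕ) : NumberField.RingOfIntegers ℚ) ∈ v.asIdeal ∧ W.HasMultiplicativeReductionAt v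
      · by_cases h14 : Nat.card (W.selmerGroup 2) = 1 ∨ Nat.card (W.selmerGroup 2) = 4
        · obtain ⟨v, h2v, hNv, hmv⟩ := hmult
          obtain ⟨K, _, _, hIQ, hodd, h3, hHe, hsq1, hsq2, Dt, β, ι, d₁, hoptDt, hc, hy, M₀, hdiv, hndiv,
            n, d, hn, hKoly, hPn, Wd, _, _, hWd, hcmd, hrd, hSel, hDEF⟩ := hPG W hcm hr0 hρ hT hneg hopt h14
          have hBd : Literature.NumberTheory.EllipticCurves.BSDp Wd 2 := hTw Wd hcmd hrd hSel
          exact hG W hcm hr0 hρ hT K hIQ hodd h3 hHe Dt hoptDt hc β ι d₁ hy M₀ hdiv hndiv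
            (hQ3RT hQ2 hQ5R hQ1 W hcm hT v h2v hNv hmv hneg K hIQ hodd h3 hHe hsq1 hsq2 hρ Dt β ι d₁ hy M₀ hdiv hndiv
              (hw Dt) Wd hWd hSel hDEF n d hn hKoly hPn)
            Wd hWd hSel hBd
        · exact hWide W hcm hr0 hρ hT hopt hneg hmult h14
      · exact hAdd W hcm hr0 hρ hT hopt hmult
    · -- `Δ > 0`: THE NEW BRANCH — the shallow narrow supply⁺ feeds Q4_T′ on the cut; complements = the SAME two residuals, now sign-free
      by_cases hmult : ∃ v : IsDedekindDomain.HeightOneSpectrum (NumberField.RingOfIntegers ℚ),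
          ((2 : ℕ) : NumberField.RingOfIntegers ℚ) ∉ v.asIdeal ∧
          ((W.conductorNorm ℤ : ℕ) : NumberField.RingOfIntegers ℚ) ∈ v.asIdeal ∧ W.HasMultiplicativeReductionAt v
      · by_cases h14 : Nat.card (W.selmerGroup 2) = 1 ∨ (Nat.card (W.selmerGroup 2) = 4 ∧
            ∃ c ∈ (W.kummerSelmerStructure ((2 : ℕ) : ℤ)).selmerGroup,
              Literature.NumberTheory.GaloisRepresentations.galoisCohomology.localization (W.torsionGaloisModule ((2 : ℕ) : ℤ))
                (Sum.inl Rat.infinitePlace) 1 c ≠ 0)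
        · obtain ⟨v, h2v, hNv, hmv⟩ := hmult
          obtain ⟨K, _, _, hIQ, hodd, h3, hHe, hsq1, hsq2, Dt, β, ι, d₁, hoptDt, hc, hy, M₀, hdiv, hndiv,
            n, d, hn, hKoly, hPn, Wd, _, _, hWd, hcmd, hrd, hSel, hTam⟩ := hP W hcm hr0 hρ hT hpos hopt h14
          have hBd : Literature.NumberTheory.EllipticCurves.BSDp Wd 2 := hTw Wd hcmd hrd hSel
          exact hG W hcm hr0 hρ hT K hIQ hodd h3 hHe Dt hoptDt hc β ι d₁ hy M₀ hdiv hndiv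
            (hQ4T hQ2 W hcm hT v h2v hNv hmv hpos K hIQ hodd h3 hHe hsq1 hsq2 hρ Dt β ι d₁ hy M₀ hdiv hndiv (hw Dt) Wd hWd hSel hTam
              n d hn hKoly hPn)
            Wd hWd hSel hBd
        · exact hWidePos W hcm hr0 hρ hT hopt hpos hmult h14
      · exact hAdd W hcm hr0 hρ hT hopt hmult
  · exact hR W hcm hr hH

end Summit.BirchSwinnertonDyer.BirchSwinnertonDyer.Cruxes.ShaCardDvdPowAtTwoPosT.R9final
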